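import Summits.MatrixMultiplication.MatrixMultiplication.Theorems.AbelianSTPPCensusShapeCertVQDefsP
import Summits.MatrixMultiplication.MatrixMultiplication.Theorems.AbelianSTPPCensusShapeCertVQSearchE

/-!
# Abelian STPP census — PATH SEGMENTS of `ShapeCertVQ.checkQE`: how the pieces assemble

Cell mm-stpp, rung F-M1; successor kernel item VQ-CERT (T_E beyond 337 under vQ := vP ∧ E3⁺) in support of the closed crux item
stmt-MatrixMultiplication-19191; seat mm-stpp-vp-p2 (gen 1).  Pure bookkeeping about the Boolean search (no mathematics):
* `dfsQE_succ_eq` — one level of `dfsQE` = node decision (`nodeDecQE`), else the walk (`nodeWalkQE` with enough steps);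
* `segLoopQ_append` — consecutive segments of one node concatenate; `segLoopQ_eq_loopQ` — a segment longer than the pool is the walk;
* `pathSegQE_append` / `pathOK_of_seg` — segments of a node concatenate, and one covering its pool gives the node (`PathOK`);
* `pathSeg_single_of_child` — a node gives the one-candidate segment of its parent at its index (given any evaluated sibling
  segment, which vouches for the parent's node-level decision);
* `checkQE_of_pathOK_nil` — the root node is `checkQE M`.
So an order is certified by kernel-evaluating a tree of `pathSegQE` facts and folding them with these lemmas (seat generator).
-/

set_option linter.dupNamespace false -- `MatrixMultiplication.MatrixMultiplication` (summit = problem, D-0017)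
set_option autoImplicit false

namespace Summit.MatrixMultiplication.MatrixMultiplication.Theorems.ShapeCertVQ

open ShapeCert ShapeCertVP

section segs
variable {M : ℕ} {rec : List Sh → List Sh → Bool} {fam : List Sh} {A : Agg} {ra rb rc vl g0 q : ℕ} {sel : B8 → ℕ}
  {mdk lb1 : ℕ} {cl : Bool}

/-- consecutive walk segments concatenate -/
theorem segLoopQ_append : ∀ (n m : ℕ) (L : List Sh),
    segLoopQ M rec fam A ra rb rc vl g0 q sel mdk lb1 cl n L = true →
    segLoopQ M rec fam A ra rb rc vl g0 q sel mdk lb1 cl m (L.drop n) = true →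
    segLoopQ M rec fam A ra rb rc vl g0 q sel mdk lb1 cl (n + m) L = true
  | 0, m, L, _, h2 => by simpa using h2
  | n + 1, 0, [], h1, _ => by simpa [segLoopQ] using h1
  | n + 1, m + 1, [], h1, _ => by
    rw [show n + 1 + (m + 1) = (n + m + 1) + 1 by omega, segLoopQ]; rw [segLoopQ] at h1; exact h1
  | n + 1, m, t :: rest, h1, h2 => by
    rw [Nat.add_right_comm, segLoopQ]
    rw [segLoopQ] at h1
    rw [List.drop_succ_cons] at h2
    by_cases hbr : t.lev < lb1
    · rw [if_pos hbr]
    · rw [if_neg hbr] at h1 ⊢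
      by_cases hsk : ra < t.wA ∨ rb < t.wB ∨ rc < t.wC ∨ vl < t.V
      · rw [if_pos hsk] at h1 ⊢; exact segLoopQ_append n m rest h1 h2
      · rw [if_neg hsk] at h1 ⊢
        rw [Bool.and_eq_true] at h1 ⊢
        exact ⟨h1.1, segLoopQ_append n m rest h1.2 h2⟩

/-- a segment longer than the list is the whole walk -/
theorem segLoopQ_eq_loopQ : ∀ (n : ℕ) (L : List Sh), L.length < n →
    segLoopQ M rec fam A ra rb rc vl g0 q sel mdk lb1 cl n L = loopQ M rec fam A ra rb rc vl g0 q sel mdk lb1 cl L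
  | 0, _, h => absurd h (Nat.not_lt_zero _)
  | n + 1, [], _ => by rw [segLoopQ, loopQ]
  | n + 1, t :: rest, h => by
    rw [segLoopQ, loopQ]
    have ih := segLoopQ_eq_loopQ n rest (by simpa using h)
    simp only [ih]

end segs

section node
variable {M : ℕ}

/-- **one level of the budgeted search, decomposed**: the node decision, else the walk (with at least as many steps as candidates) -/
theorem dfsQE_succ_eq (fuel : ℕ) (fam L : List Sh) {n : ℕ} (hn : L.length < n) :
    dfsQE M (fuel + 1) fam L =
      (match nodeDecQE M fam with
       | some b => b
       | none => nodeWalkQE M (dfsQE M fuel) fam n L) := by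
  rw [dfsQE]
  unfold nodeDecQE nodeWalkQE
  simp only [Agg.force_eq, seqN_eq]
  rw [segLoopQ_eq_loopQ n L hn]
  split_ifs <;> rfl

end node

section paths
variable {M : ℕ}

/-- pools only shrink along a path -/
theorem pathNode_pool_length (M : ℕ) : ∀ path : List ℕ, ((pathNode M path).2).length ≤ (candQ M).length
  | [] => le_rfl
  | k :: ks => by
    have ih := pathNode_pool_length M ks
    rw [pathNode]
    cases hd : ((pathNode M ks).2).drop k with
    | nil => simp
    | cons t rest =>
      simp only
      have : (t :: rest).length = ((pathNode M ks).2).length - k := by rw [← hd, List.length_drop]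
      simp only [List.length_cons] at this ⊢
      omega

/-- so every pool has fewer than `9999` entries -/
theorem pathNode_pool_lt (M : ℕ) (path : List ℕ) : ((pathNode M path).2).length < 9999 :=
  lt_of_le_of_lt ((pathNode_pool_length M path).trans (candQ_length_le M)) (by norm_num)

/-- **consecutive segments of one node concatenate** -/
theorem pathSegQE_append {path : List ℕ} {i n m : ℕ} (h1 : pathSegQE M path i n = true)
    (h2 : pathSegQE M path (i + n) m = true) : pathSegQE M path i (n + m) = true := by
  unfold pathSegQE at h1 h2 ⊢
  cases hdec : nodeDecQE M (pathNode M path).1 with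
  | some b => simpa [hdec] using h1
  | none =>
    simp only [hdec] at h1 h2 ⊢
    unfold nodeWalkQE at h1 h2 ⊢
    simp only [Agg.force_eq, seqN_eq] at h1 h2 ⊢
    rw [← List.drop_drop] at h2
    exact segLoopQ_append n m _ h1 h2

/-- **one segment covering the whole pool of a node gives the node** -/
theorem pathOK_of_seg {path : List ℕ} {n : ℕ} (h : pathSegQE M path 0 n = true) (hn : ((pathNode M path).2).length < n)
    (hd : path.length ≤ M + 1) : PathOK M path := by
  unfold PathOK
  rw [show M + 2 - path.length = (M + 1 - path.length) + 1 by omega, dfsQE_succ_eq _ _ _ hn]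
  unfold pathSegQE at h
  rw [List.drop_zero] at h
  exact h

/-- **a node gives the one-candidate segment of its parent** (an evaluated sibling segment vouches for the parent's node decision;
if the index is past the pool, the child is the parent with an empty pool and both sides are the parent's closure value) -/
theorem pathSeg_single_of_child {path : List ℕ} {k j m : ℕ} (hsib : pathSegQE M path j m = true) (hchild : PathOK M (k :: path))
    (hd : path.length ≤ M) : pathSegQE M path k 1 = true := by
  unfold PathOK at hchild
  have hfuel : M + 2 - (k :: path).length = (M - path.length) + 1 := by simp only [List.length_cons]; omega
  rw [hfuel] at hchild
  unfold pathSegQE at hsib ⊢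
  cases hdec : nodeDecQE M (pathNode M path).1 with
  | some b => simpa [hdec] using hsib
  | none =>
    simp only [hdec] at hsib ⊢
    have hrec : M + 1 - path.length = (M - path.length) + 1 := by omega
    rw [hrec]
    cases hdk : ((pathNode M path).2).drop k with
    | nil =>
      have hnode : pathNode M (k :: path) = ((pathNode M path).1, []) := by rw [pathNode, hdk]
      rw [hnode] at hchild
      simp only at hchild
      rw [dfsQE_succ_eq _ _ _ (n := 1) (by simp), hdec] at hchild
      simp only at hchild
      unfold nodeWalkQE at hchild ⊢
      simp only [Agg.force_eq, seqN_eq] at hchild ⊢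
      rw [segLoopQ] at hchild ⊢
      exact hchild
    | cons t rest =>
      have hnode : pathNode M (k :: path) = (t :: (pathNode M path).1, t :: rest) := by rw [pathNode, hdk]
      rw [hnode] at hchild
      simp only at hchild
      unfold nodeWalkQE
      simp only [Agg.force_eq, seqN_eq]
      rw [segLoopQ]
      split_ifs with hbr hsk
      · rfl
      · rw [segLoopQ]
      · rw [segLoopQ, Bool.and_true]
        unfold stepQ
        simp only [Agg.force_eq]
        split_ifs <;> first | rfl | exact hchild

/-- **the root node is the certificate** -/
theorem checkQE_of_pathOK_nil (h : PathOK M []) : checkQE M = true := by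
  unfold PathOK at h; simpa [pathNode, checkQE] using h

end paths

end Summit.MatrixMultiplication.MatrixMultiplication.Theorems.ShapeCertVQ
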